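import Mathlib.Analysis.SpecialFunctions.Pow.Real
import Mathlib.Analysis.SpecialFunctions.Log.Basic
import Mathlib.Analysis.SpecialFunctions.Sqrt
import Mathlib.Analysis.Complex.ExponentialBounds
import HarnessLib

/-!
# The class prime number theorem with the Deuring–Heilbronn phenomenon, II′: real-variable bookkeeping

Topic `Summits/QuantumAdvantage/QuantumAdvantage/Theorems`, cell B2b-1 (linnik-cubic), PART A (gen 4);
helper toward the crux `DegreeOnePrimesEscape` (stmt-QuantumAdvantage-11543) of route
`LinnikCubicClassGroups`.  HONEST FRAMING: the value of this file is a THEOREM (kernel-checked) — NOT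
summit progress (the route still rests on the hypothesis-type target `PureCubicClassNumberHard`).

Pure real-variable lemmas used by the Deuring–Heilbronn form of the smoothed class prime number theorem
(file III, `…ClassPNTDHSmoothed.lean`):

* `mul_rpow_neg_le_one_of_threshold` — `M Q^k x^{−ν} ≤ 1` once `x ≥ Q^{a}`, `aν ≥ k + max(0, log M)`;
* `dhRegime_zeroSum_small` — in the Deuring–Heilbronn regime `2Cn η₁ ≤ 1/3` (`η₁ = (1 − β₁) log x`),
  with `c_Z = min(log(1/(2Cnη₁))/(Cn), a log Q/2)`, the density-times-repulsion bound
  `A₀ (e^{−c_Z L/(4a log Q)} + e^{−√(c_Z L/4)})` is `≤ (η/4) η₁` for `L ≥ a₁ log Q`, `a₁` large;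
* `junk_small` — the trivial-zero, left-line and tail terms `A₀ x^{1−ν} + h(1152 x^{1/4} + C_J)` are
  `≤ (η/4) x · c₁ Q^{−2}` for `x ≥ Q^{a₁}`, `a₁` large.

Reference for the shape of the argument: J. Thorner, A. Zaman, Algebra Number Theory 13 (2019), §5
[ThornerZaman2019].
-/

noncomputable section

open Real

namespace Summit.QuantumAdvantage.QuantumAdvantage.Theorems.DegreeOnePrimesEscape

/-! ### Real-variable bookkeeping -/

/-- **Absorption of a power of `Q` by `x^{−ν}`**: for `Q ≥ 12`, `x ≥ Q^{a}`, `ν > 0`, `M > 0`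
and `a ν ≥ k + max(0, log M)`: `M · Q^k · x^{−ν} ≤ 1`. [folklore] -/
theorem mul_rpow_neg_le_one_of_threshold {Q x a ν k M : ℝ} (hQ : 12 ≤ Q) (hx : Q ^ a ≤ x)
    (hν : 0 < ν) (hM : 0 < M) (ha : k + max 0 (Real.log M) ≤ a * ν) :
    M * Q ^ k * x ^ (-ν) ≤ 1 := by
  have hQ0 : 0 < Q := by linarith
  have hQ1 : (1 : ℝ) ≤ Q := by linarith
  have hQa : 0 < Q ^ a := Real.rpow_pos_of_pos hQ0 a
  have hlog12 : (1 : ℝ) ≤ Real.log 12 := by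
    rw [Real.le_log_iff_exp_le (by norm_num)]
    have := Real.exp_one_lt_d9; linarith
  have hlogQ : 1 ≤ Real.log Q := hlog12.trans (Real.log_le_log (by norm_num) hQ)
  -- `x^{-ν} ≤ Q^{-aν}`
  have h1 : x ^ (-ν) ≤ (Q ^ a) ^ (-ν) := Real.rpow_le_rpow_of_nonpos hQa hx (by linarith)
  rw [← Real.rpow_mul hQ0.le] at h1
  set m : ℝ := max 0 (Real.log M) with hm
  have hm0 : 0 ≤ m := le_max_left _ _
  have hmM : Real.log M ≤ m := le_max_right _ _
  -- `Q^k Q^{-aν} = Q^{-(aν - k)} ≤ Q^{-m} ≤ e^{-m} ≤ 1/M`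
  have h2 : Q ^ k * Q ^ (a * -ν) = Q ^ (-(a * ν - k)) := by
    rw [← Real.rpow_add hQ0]; ring_nf
  have h3 : Q ^ (-(a * ν - k)) ≤ Q ^ (-m) := Real.rpow_le_rpow_of_exponent_le hQ1 (by linarith)
  have h4 : Q ^ (-m) ≤ Real.exp (-m) := by
    rw [Real.rpow_def_of_pos hQ0, Real.exp_le_exp]; nlinarith
  have h5 : Real.exp (-m) ≤ 1 / M := by
    rw [Real.exp_neg, one_div]
    refine inv_anti₀ hM ?_
    calc M = Real.exp (Real.log M) := (Real.exp_log hM).symm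
      _ ≤ Real.exp m := Real.exp_le_exp.2 hmM
  calc M * Q ^ k * x ^ (-ν) ≤ M * Q ^ k * Q ^ (a * -ν) :=
        mul_le_mul_of_nonneg_left h1 (by positivity)
    _ = M * (Q ^ k * Q ^ (a * -ν)) := by ring
    _ = M * Q ^ (-(a * ν - k)) := by rw [h2]
    _ ≤ M * (1 / M) := mul_le_mul_of_nonneg_left ((h3.trans h4).trans h5) hM.le
    _ = 1 := by field_simp

/-! ### The junk terms -/

/-- **The trivial-zero, left-line and tail terms are `≤ (η/4) x · c₁Q^{−2}`**: for `Q ≥ 12`,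
`x ≥ Q^{a₁}` (`a₁ ≥ 32`, `a₁ν ≥ 2 + max(0, log(4(A₀ + 1152 + C_J)/(ηc₁)))`), `0 < ν ≤ 1/64`,
`h ≤ Q⁴`:  `A₀ x^{1−ν} + h (1152 e^{(log x)/4} + C_J) ≤ (η/4)·x·(c₁ Q^{−2})`. [folklore] -/
theorem junk_small {A₀ CJ h Q x ν η c₁ a₁ : ℝ} (hA₀ : 0 < A₀) (hCJ : 0 ≤ CJ) (hQ : 12 ≤ Q)
    (hh : h ≤ Q ^ 4) (hν : 0 < ν) (hν1 : ν ≤ 1 / 64) (hη : 0 < η) (hc₁ : 0 < c₁)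
    (hx : Q ^ a₁ ≤ x) (ha₁ : 32 ≤ a₁)
    (ha₁J : (2 + max 0 (Real.log (4 * (A₀ + 1152 + CJ) / (η * c₁)))) / ν ≤ a₁) :
    A₀ * x ^ (1 - ν) + h * (1152 * Real.exp (Real.log x / 4) + CJ) ≤
      η / 4 * x * (c₁ * Q ^ (-(2 : ℝ))) := by
  have hQ0 : 0 < Q := by linarith
  have hQ1 : (1 : ℝ) ≤ Q := by linarith
  have hxQ : Q ≤ x := by
    have := Real.rpow_le_rpow_of_exponent_le hQ1 (by linarith : (1 : ℝ) ≤ a₁)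
    rw [Real.rpow_one] at this; exact this.trans hx
  have hx1 : (1 : ℝ) ≤ x := by linarith
  have hx0 : 0 < x := by linarith
  -- `h ≤ Q⁴ ≤ x^{1/8}`
  have hQ4 : Q ^ 4 ≤ x ^ ((1 : ℝ) / 8) := by
    have h1 : (Q ^ (4 : ℕ) : ℝ) = (Q ^ a₁) ^ ((4 : ℝ) / a₁) := by
      rw [← Real.rpow_mul hQ0.le, mul_div_cancel₀ _ (by linarith : a₁ ≠ 0)]
      norm_cast
    rw [h1]
    calc (Q ^ a₁) ^ ((4 : ℝ) / a₁) ≤ x ^ ((4 : ℝ) / a₁) :=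
          Real.rpow_le_rpow (Real.rpow_nonneg hQ0.le _) hx (by positivity)
      _ ≤ x ^ ((1 : ℝ) / 8) := by
          refine Real.rpow_le_rpow_of_exponent_le hx1 ?_
          rw [div_le_iff₀ (by linarith)]; linarith
  have hh' : h ≤ x ^ ((1 : ℝ) / 8) := hh.trans hQ4
  -- `e^{(log x)/4} = x^{1/4}`
  have hexp : Real.exp (Real.log x / 4) = x ^ ((1 : ℝ) / 4) := by
    rw [Real.rpow_def_of_pos hx0]; ring_nf
  -- each junk term is `≤ const · x^{1−ν}`
  have hpow1 : x ^ ((1 : ℝ) / 8) * x ^ ((1 : ℝ) / 4) ≤ x ^ (1 - ν) := by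
    rw [← Real.rpow_add hx0]
    exact Real.rpow_le_rpow_of_exponent_le hx1 (by linarith)
  have hpow2 : x ^ ((1 : ℝ) / 8) ≤ x ^ (1 - ν) := Real.rpow_le_rpow_of_exponent_le hx1 (by linarith)
  have hJ1 : h * (1152 * Real.exp (Real.log x / 4)) ≤ 1152 * x ^ (1 - ν) := by
    rw [hexp]
    calc h * (1152 * x ^ ((1 : ℝ) / 4)) ≤ x ^ ((1 : ℝ) / 8) * (1152 * x ^ ((1 : ℝ) / 4)) :=
          mul_le_mul_of_nonneg_right hh' (by positivity)
      _ = 1152 * (x ^ ((1 : ℝ) / 8) * x ^ ((1 : ℝ) / 4)) := by ring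
      _ ≤ 1152 * x ^ (1 - ν) := mul_le_mul_of_nonneg_left hpow1 (by norm_num)
  have hJ2 : h * CJ ≤ CJ * x ^ (1 - ν) := by
    calc h * CJ ≤ x ^ ((1 : ℝ) / 8) * CJ := mul_le_mul_of_nonneg_right hh' hCJ
      _ = CJ * x ^ ((1 : ℝ) / 8) := mul_comm _ _
      _ ≤ CJ * x ^ (1 - ν) := mul_le_mul_of_nonneg_left hpow2 hCJ
  have hsum : A₀ * x ^ (1 - ν) + h * (1152 * Real.exp (Real.log x / 4) + CJ) ≤
      (A₀ + 1152 + CJ) * x ^ (1 - ν) := by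
    rw [mul_add h]; nlinarith [hJ1, hJ2]
  -- the threshold: `(4 A_J/(η c₁)) Q² x^{-ν} ≤ 1`
  set AJ : ℝ := A₀ + 1152 + CJ with hAJ
  have hAJ0 : 0 < AJ := by rw [hAJ]; positivity
  have hth := mul_rpow_neg_le_one_of_threshold (k := 2) (M := 4 * AJ / (η * c₁)) hQ hx hν
    (by positivity) (by have := (div_le_iff₀ hν).1 ha₁J; linarith)
  have hxν : x ^ (1 - ν) = x * x ^ (-ν) := by
    rw [sub_eq_add_neg, Real.rpow_add hx0, Real.rpow_one]
  have hQ2 : Q ^ (2 : ℝ) * Q ^ (-(2 : ℝ)) = 1 := by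
    rw [← Real.rpow_add hQ0]; norm_num
  have hQm2 : 0 < Q ^ (-(2 : ℝ)) := Real.rpow_pos_of_pos hQ0 _
  refine hsum.trans ?_
  rw [hxν]
  -- multiply `hth` by `(η c₁ / 4) Q^{-2} x`
  have := mul_le_mul_of_nonneg_left hth (by positivity : (0 : ℝ) ≤ η / 4 * x * (c₁ * Q ^ (-(2 : ℝ))))
  rw [mul_one] at this
  refine le_trans (le_of_eq ?_) this
  have hη0 : η ≠ 0 := hη.ne'
  have hc0 : c₁ ≠ 0 := hc₁.ne'
  calc AJ * (x * x ^ (-ν)) = AJ * (x * x ^ (-ν)) * (Q ^ (2 : ℝ) * Q ^ (-(2 : ℝ))) := by rw [hQ2, mul_one]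
    _ = η / 4 * x * (c₁ * Q ^ (-(2 : ℝ))) * (4 * AJ / (η * c₁) * Q ^ (2 : ℝ) * x ^ (-ν)) := by
        field_simp

/-! ### The Deuring–Heilbronn regime -/

/-- `e^{−2 log(1/u)} = u²` for `u > 0`. [folklore] -/
theorem exp_neg_two_mul_log_one_div {u : ℝ} (hu : 0 < u) : Real.exp (-(2 * Real.log (1 / u))) = u ^ 2 := by
  rw [one_div, Real.log_inv, show -(2 * -Real.log u) = Real.log u * 2 by ring, ← Real.rpow_def_of_pos hu,
    ← Real.rpow_natCast]
  norm_num

/-- **The zero sum in the Deuring–Heilbronn regime.**  With `η₁ = (1 − β₁) log x` in the regime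
`2Cnη₁ ≤ 1/3`, `η₁ ≤ η/(32 A₀ C² n²)`, `η₁ ≥ c₁ e^{−2 log Q}`, and
`c_Z = min(log(1/(2Cnη₁))/(Cn), a log Q/2)`, for `L ≥ a₁ log Q` with
`a₁ ≥ 8aCn`, `a₁ ≥ 32Cn + 16Cn·max(0, log(1/(2Cnc₁)))`, `a₁ ≥ 8(2 + max(0, log(8A₀/(ηc₁))))²`:
`A₀ (e^{−c_Z L/(4a log Q)} + e^{−√(c_Z L/4)}) ≤ (η/4) η₁`.  (First alternative of the `min`: both
exponentials are `≤ e^{−2 log(1/(2Cnη₁))} = (2Cnη₁)²`; second: both are `≤ (ηc₁/(8A₀)) e^{−2 log Q}`.)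
[cite: ThornerZaman2019, §5] -/
theorem dhRegime_zeroSum_small {A₀ C n η η₁ c₁ a lQ L a₁ : ℝ} (hA₀ : 0 < A₀) (hC : 0 < C)
    (hn : 2 ≤ n) (hη : 0 < η) (hc₁ : 0 < c₁) (ha : 1 ≤ a) (hlQ : 1 ≤ lQ) (hη₁0 : 0 < η₁)
    (hη₁low : c₁ * Real.exp (-(2 * lQ)) ≤ η₁) (hη₁C : 2 * C * n * η₁ ≤ 1 / 3)
    (hη₁A : η₁ ≤ η / (32 * A₀ * C ^ 2 * n ^ 2)) (hL : a₁ * lQ ≤ L) (ha₁1 : 8 * a * C * n ≤ a₁)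
    (ha₁2 : 32 * C * n + 16 * C * n * max 0 (Real.log (1 / (2 * C * n * c₁))) ≤ a₁)
    (ha₁3 : 8 * (2 + max 0 (Real.log (8 * A₀ / (η * c₁)))) ^ 2 ≤ a₁) :
    A₀ * (Real.exp (-(min (Real.log (1 / (2 * C * n * η₁)) / (C * n)) (a * lQ / 2) * L / (4 * a * lQ))) +
      Real.exp (-Real.sqrt (min (Real.log (1 / (2 * C * n * η₁)) / (C * n)) (a * lQ / 2) * L / 4))) ≤
      η / 4 * η₁ := by
  have hn0 : 0 < n := by linarith
  have hCn : 0 < C * n := mul_pos hC hn0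
  have haCn : 0 < 8 * a * C * n := by positivity
  have ha₁0 : 0 < a₁ := lt_of_lt_of_le haCn ha₁1
  set u : ℝ := 2 * C * n * η₁ with hu
  have hu0 : 0 < u := by positivity
  set ℓ : ℝ := Real.log (1 / u) with hℓ
  have hℓ0 : 0 ≤ ℓ := by
    rw [hℓ]; refine Real.log_nonneg ?_
    rw [le_div_iff₀ hu0]; linarith
  have hLa₁ : a₁ ≤ L := by
    have : a₁ * 1 ≤ a₁ * lQ := mul_le_mul_of_nonneg_left hlQ ha₁0.le
    linarith
  have hL0 : 0 < L := by linarith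
  set Λe : ℝ := max 0 (Real.log (8 * A₀ / (η * c₁))) with hΛe
  have hΛe0 : 0 ≤ Λe := le_max_left _ _
  -- the target size in the second alternative: `e^{-Λe} ≤ η c₁/(8 A₀)`
  have heΛ : Real.exp (-Λe) ≤ η * c₁ / (8 * A₀) := by
    rw [Real.exp_neg]
    have h1 : 8 * A₀ / (η * c₁) ≤ Real.exp Λe := by
      calc 8 * A₀ / (η * c₁) = Real.exp (Real.log (8 * A₀ / (η * c₁))) :=
            (Real.exp_log (by positivity)).symm
        _ ≤ Real.exp Λe := Real.exp_le_exp.2 (le_max_right _ _)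
    calc (Real.exp Λe)⁻¹ ≤ (8 * A₀ / (η * c₁))⁻¹ := inv_anti₀ (by positivity) h1
      _ = η * c₁ / (8 * A₀) := by rw [inv_div]
  rcases le_total (ℓ / (C * n)) (a * lQ / 2) with hcase | hcase
  · -- first alternative: `c_Z = ℓ/(Cn)`
    rw [min_eq_left hcase]
    -- `ℓ ≤ 2 lQ + κ₁`
    set κ₁ : ℝ := max 0 (Real.log (1 / (2 * C * n * c₁))) with hκ₁
    have hκ₁0 : 0 ≤ κ₁ := le_max_left _ _
    have hℓle : ℓ ≤ 2 * lQ + κ₁ := by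
      have h1 : 1 / u ≤ Real.exp (2 * lQ) / (2 * C * n * c₁) := by
        rw [hu, div_le_div_iff₀ hu0 (by positivity), one_mul]
        have := mul_le_mul_of_nonneg_left hη₁low (by positivity : (0 : ℝ) ≤ 2 * C * n)
        calc 2 * C * n * c₁ = 2 * C * n * (c₁ * Real.exp (-(2 * lQ))) * Real.exp (2 * lQ) := by
              rw [Real.exp_neg]; field_simp
          _ ≤ 2 * C * n * η₁ * Real.exp (2 * lQ) := mul_le_mul_of_nonneg_right this (by positivity)
          _ = Real.exp (2 * lQ) * (2 * C * n * η₁) := by ring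
      have h2 : ℓ ≤ Real.log (Real.exp (2 * lQ) / (2 * C * n * c₁)) :=
        Real.log_le_log (by positivity) h1
      rw [Real.log_div (by positivity) (by positivity), Real.log_exp] at h2
      have h3 : -Real.log (2 * C * n * c₁) ≤ κ₁ := by
        rw [← Real.log_inv, ← one_div]; exact le_max_right _ _
      linarith
    -- `L ≥ 16 C n ℓ` and `L ≥ 8 a C n lQ`
    have hL16 : 16 * (C * n) * ℓ ≤ L := by
      have h1 : 16 * (C * n) * ℓ ≤ 16 * (C * n) * (2 * lQ + κ₁) :=
        mul_le_mul_of_nonneg_left hℓle (by positivity)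
      have h2 : (32 * C * n + 16 * C * n * κ₁) * lQ ≤ a₁ * lQ :=
        mul_le_mul_of_nonneg_right ha₁2 (by linarith)
      have h3 : 16 * C * n * κ₁ * 1 ≤ 16 * C * n * κ₁ * lQ :=
        mul_le_mul_of_nonneg_left hlQ (by positivity)
      have e1 : 16 * (C * n) * (2 * lQ + κ₁) = 32 * C * n * lQ + 16 * C * n * κ₁ := by ring
      have e2 : (32 * C * n + 16 * C * n * κ₁) * lQ = 32 * C * n * lQ + 16 * C * n * κ₁ * lQ := by ring
      linarith
    have hL8 : 2 * (4 * a * lQ * (C * n)) ≤ L := by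
      have h1 := mul_le_mul_of_nonneg_right ha₁1 (by linarith : (0 : ℝ) ≤ lQ)
      have e : 2 * (4 * a * lQ * (C * n)) = 8 * a * C * n * lQ := by ring
      linarith
    -- both exponentials are `≤ e^{-2ℓ} = u²`
    have hE1 : Real.exp (-(ℓ / (C * n) * L / (4 * a * lQ))) ≤ Real.exp (-(2 * ℓ)) := by
      rw [Real.exp_le_exp, neg_le_neg_iff]
      rw [show ℓ / (C * n) * L / (4 * a * lQ) = ℓ * (L / (4 * a * lQ * (C * n))) by
        field_simp]
      have h1 : 2 ≤ L / (4 * a * lQ * (C * n)) := by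
        rw [le_div_iff₀ (by positivity)]; exact hL8
      have := mul_le_mul_of_nonneg_left h1 hℓ0
      linarith
    have hE2 : Real.exp (-Real.sqrt (ℓ / (C * n) * L / 4)) ≤ Real.exp (-(2 * ℓ)) := by
      rw [Real.exp_le_exp, neg_le_neg_iff]
      have h1 : (2 * ℓ) ^ 2 ≤ ℓ / (C * n) * L / 4 := by
        rw [show ℓ / (C * n) * L / 4 = ℓ * (L / (4 * (C * n))) by field_simp]
        have h2 : 4 * ℓ ≤ L / (4 * (C * n)) := by
          rw [le_div_iff₀ (by positivity)]
          have e : 4 * ℓ * (4 * (C * n)) = 16 * (C * n) * ℓ := by ring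
          linarith
        have := mul_le_mul_of_nonneg_left h2 hℓ0
        nlinarith
      exact Real.le_sqrt_of_sq_le h1
    have hu2 : Real.exp (-(2 * ℓ)) = u ^ 2 := by rw [hℓ]; exact exp_neg_two_mul_log_one_div hu0
    rw [hu2] at hE1 hE2
    -- `2 A₀ u² = 8 A₀ C² n² η₁ · η₁ ≤ (η/4) η₁`
    have hfin : A₀ * (u ^ 2 + u ^ 2) ≤ η / 4 * η₁ := by
      have h1 : η₁ * (32 * A₀ * C ^ 2 * n ^ 2) ≤ η := by
        have := (le_div_iff₀ (by positivity)).1 hη₁A; linarith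
      have h2 : A₀ * (u ^ 2 + u ^ 2) = η₁ * (32 * A₀ * C ^ 2 * n ^ 2) * η₁ / 4 := by rw [hu]; ring
      rw [h2]
      have := mul_le_mul_of_nonneg_right h1 hη₁0.le
      linarith
    calc A₀ * (Real.exp (-(ℓ / (C * n) * L / (4 * a * lQ))) + Real.exp (-Real.sqrt (ℓ / (C * n) * L / 4)))
        ≤ A₀ * (u ^ 2 + u ^ 2) := mul_le_mul_of_nonneg_left (add_le_add hE1 hE2) hA₀.le
      _ ≤ η / 4 * η₁ := hfin
  · -- second alternative: `c_Z = a lQ / 2`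
    rw [min_eq_right hcase]
    -- `a₁ ≥ 16 (2 + Λe)` and `√(a₁/8) ≥ 2 + Λe`
    have h2Λ : 2 ≤ 2 + Λe := by linarith
    have hsq8 : (2 + Λe) ^ 2 ≤ a₁ / 8 := by linarith
    have ha₁' : 16 * (2 + Λe) ≤ a₁ := by
      have : 2 * (2 + Λe) ≤ (2 + Λe) ^ 2 := by nlinarith
      linarith
    -- first exponential: `e^{-L/8} ≤ e^{-(2 + Λe) lQ}`
    have hE1 : Real.exp (-(a * lQ / 2 * L / (4 * a * lQ))) ≤ Real.exp (-((2 + Λe) * lQ)) := by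
      rw [show a * lQ / 2 * L / (4 * a * lQ) = L / 8 by field_simp; ring, Real.exp_le_exp,
        neg_le_neg_iff]
      have h1 : 16 * (2 + Λe) * lQ ≤ a₁ * lQ := mul_le_mul_of_nonneg_right ha₁' (by linarith)
      have h2 : 0 ≤ (2 + Λe) * lQ := by positivity
      linarith
    -- second exponential: `√(a lQ L / 8) ≥ lQ √(a₁/8) ≥ (2 + Λe) lQ`
    have hE2 : Real.exp (-Real.sqrt (a * lQ / 2 * L / 4)) ≤ Real.exp (-((2 + Λe) * lQ)) := by
      rw [Real.exp_le_exp, neg_le_neg_iff]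
      have h1 : ((2 + Λe) * lQ) ^ 2 ≤ a * lQ / 2 * L / 4 := by
        have h3 : (2 + Λe) ^ 2 * lQ ^ 2 ≤ a₁ / 8 * lQ ^ 2 :=
          mul_le_mul_of_nonneg_right hsq8 (sq_nonneg lQ)
        -- `a₁ lQ² ≤ L lQ ≤ a L lQ`
        have h4 : a₁ * lQ * lQ ≤ L * lQ := mul_le_mul_of_nonneg_right hL (by linarith)
        have h5 : L * lQ ≤ a * L * lQ := by
          have : 1 * (L * lQ) ≤ a * (L * lQ) := mul_le_mul_of_nonneg_right ha (by positivity)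
          linarith
        have e1 : ((2 + Λe) * lQ) ^ 2 = (2 + Λe) ^ 2 * lQ ^ 2 := by ring
        have e2 : a₁ / 8 * lQ ^ 2 = a₁ * lQ * lQ / 8 := by ring
        have e3 : a * lQ / 2 * L / 4 = a * L * lQ / 8 := by ring
        rw [e1, e3]; rw [e2] at h3
        linarith
      exact Real.le_sqrt_of_sq_le h1
    -- `e^{-(2+Λe) lQ} ≤ e^{-2 lQ} e^{-Λe} ≤ e^{-2lQ} η c₁/(8A₀) ≤ (η/(8A₀)) η₁`
    have hE : Real.exp (-((2 + Λe) * lQ)) ≤ η / (8 * A₀) * η₁ := by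
      have h1 : Real.exp (-((2 + Λe) * lQ)) ≤ Real.exp (-(2 * lQ)) * Real.exp (-Λe) := by
        rw [← Real.exp_add, Real.exp_le_exp]
        have : Λe * 1 ≤ Λe * lQ := mul_le_mul_of_nonneg_left hlQ hΛe0
        linarith
      refine h1.trans ?_
      calc Real.exp (-(2 * lQ)) * Real.exp (-Λe) ≤ Real.exp (-(2 * lQ)) * (η * c₁ / (8 * A₀)) :=
            mul_le_mul_of_nonneg_left heΛ (by positivity)
        _ = η / (8 * A₀) * (c₁ * Real.exp (-(2 * lQ))) := by ring
        _ ≤ η / (8 * A₀) * η₁ := mul_le_mul_of_nonneg_left hη₁low (by positivity)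
    calc A₀ * (Real.exp (-(a * lQ / 2 * L / (4 * a * lQ))) + Real.exp (-Real.sqrt (a * lQ / 2 * L / 4)))
        ≤ A₀ * (η / (8 * A₀) * η₁ + η / (8 * A₀) * η₁) :=
          mul_le_mul_of_nonneg_left (add_le_add (hE1.trans hE) (hE2.trans hE)) hA₀.le
      _ = η / 4 * η₁ := by field_simp; ring

end Summit.QuantumAdvantage.QuantumAdvantage.Theorems.DegreeOnePrimesEscape

end
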